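import Summits.RiemannHypothesis.RiemannHypothesis.Theorems.SemilocalNegCertUptoHundredThreeKinkedB
import Summits.RiemannHypothesis.RiemannHypothesis.Theorems.SemilocalNegCertUptoHundredThreeKinkedC
import Summits.RiemannHypothesis.RiemannHypothesis.Theorems.SemilocalNegCertUptoHundredThreeKinkedD
import Summits.RiemannHypothesis.RiemannHypothesis.Theorems.SemilocalNegCertUptoHundredThreeKinkedE
import Summits.RiemannHypothesis.RiemannHypothesis.Theorems.SemilocalNegCertUptoHundredThreeKinkedF
import Summits.RiemannHypothesis.RiemannHypothesis.Theorems.SemilocalNegCertUptoHundredThreeKinkedG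
import Summits.RiemannHypothesis.RiemannHypothesis.Theorems.SemilocalNegCertUptoHundredThreeKinkedH
import Summits.RiemannHypothesis.RiemannHypothesis.Theorems.SemilocalNegCertUptoHundredThreeKinkedI
import Summits.RiemannHypothesis.RiemannHypothesis.Theorems.SemilocalNegCertUptoHundredThreeKinkedJ
import Summits.RiemannHypothesis.RiemannHypothesis.Theorems.SemilocalNegCertUptoHundredThreeKinkedK
import HarnessLib

/-!
# Semi-local threshold of the `{∞} ∪ {p < 107}` form, negative side: `a*({2,…,103}) ≤ 2401/1024` — the TWIN-PRIME wall `q = 107` from a KINKED (piecewise-cubic) witness (part 6/7: the composition of the 248 piece facts)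

Cell `rh-explicit` (HOME `run/shared/lean/pub/rh-explicit/`), seat cc-s2-4 gen11 (A4 SEMILOCAL-TABLE, kernel column; log of record
`HOME/cc-s2-4/CC4-LEAN.md` §16).  Honest framing: theorems about the tree's `weilSemilocalThreshold S`; nothing here bears on RH.
No data is trusted: every bound is a `decide +kernel` fact of the piecewise certificate `SemilocalPiecewiseCert.lean` (cc-s2-4 gen8).

WHY (numbers; `HOME/cc-s2-4/gen10/kinked101/KINKED-101-NOTE.md`): the second TWIN-PRIME wall `q = 107` (`q⁺ = 109`, gap `½·log(109/107)
= 0.0093`) is, like `q = 101`, out of reach of the odd-polynomial rows (certifiable knee ≈ `0.013` above the wall).  An odd PIECEWISE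
CUBIC with slope breaks at the 14 atom images `|b − log n|` nearest `0` (`n = 11, 9, 13, 8, 7, 16, 17, 19, 5, 23, 25, 27, 4, 29`, rounded to
`/1024`) gives `Re Q/‖G‖² = −2.54·10⁻⁴` at the last admissible window `b = 2401/1024 = 2.34473` (`(log 107)/2 = 2.33641`,
`(log 109)/2 = 2.34567`; float finder `pwfind.py`, form without polar credit).  Instance: `S = {p ≤ 103}`, window `N = 108` (`2b = 2401/512
= 4.6895 < log 109 = 4.6913`), 37 atoms (enclosures `SemilocalLogAtoms{,B,…,J}.lean`), 15 pieces of degree ≤ 3, orders `(10, 4, 8, 4, 10, 40)`,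
248 `t`-pieces; kernel margin `(rhs − lhs)/‖G‖² = 2.54·10⁻⁴`.  ⇒ **`a*({2,…,103}) ≤ 2401/1024 < (log 109)/2`** and `δ*(107) < 0.00832`:
with `SemilocalNegCertUptoNinetySevenKinked*` the RH-free upper clause `a*(S_q) < (log q⁺)/2` has a kernel certificate at EVERY prime
`q ≤ 131`.  The instance is split for the gate into part 1
(table, certificate, `checkMainPW`, the atom side in kernel chunks of ≤ 4 atoms via `SemilocalPiecewiseCertSplit.lean`), parts 2–5
(68 piece facts each in the FLEX layout of `SemilocalPiecewiseCertFlex.lean` (cc-s2-4 gen12, CC4-LEAN §17.2): piece `0` by `checkPiecePW`,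
every far piece by `checkPieceFlex i ⟨n, m, K, m', u₀⟩` with the orders that piece needs (mean majorant degree ≈ 62 instead of 176) and a
short dyadic centre `u₀ ≤ u_K(T₀)` — same witness, same cuts, claims recomputed (`⌈exact⌉ + 1`), kernel margin `2.5398e-04`·‖G‖²; each
fact file imports part 1 only), the Pieces part (composition) and the Final part (theorems).  Folklore.
-/

set_option autoImplicit false
set_option linter.dupNamespace false  -- the mandated namespace repeats `RiemannHypothesis`
set_option Elab.async false  -- serialise the kernel facts: in parallel they exhaust the node's per-process heap (cc-s2-4 gen11, CC4-LEAN §16.10)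

noncomputable section

open Complex Filter Set MeasureTheory Topology
open scoped Real

namespace Summit.RiemannHypothesis.RiemannHypothesis.Theorems.SemilocalPolyWitness

open MeasureTheory Set Finset Real
open Literature.NumberTheory.LFunctions
open Summit.RiemannHypothesis.RiemannHypothesis.Theorems.MotivicDoor
open Summit.RiemannHypothesis.RiemannHypothesis.Theorems.MotivicDoor.SemilocalThreshold
open Summit.RiemannHypothesis.RiemannHypothesis.Theorems.MotivicDoor.SemilocalMarkov
open LQ

set_option maxRecDepth 4000 in  -- `i < cuts.length` unfolds a 248-element list
/-- all pieces of `certUptoHundredThreeKinked` check (piece `0` with the global orders, the others in the FLEX form). -/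
theorem check_UptoHundredThreeKinked_pieces : ∀ i, i < certUptoHundredThreeKinked.cuts.length →
    certUptoHundredThreeKinked.checkPiecePW i = true ∨ ∃ o, certUptoHundredThreeKinked.checkPieceFlex i o = true := by
  intro i hi
  have hi' : i < 248 := hi
  interval_cases i
  · exact Or.inl check_UptoHundredThreeKinked_piece0
  · exact Or.inr ⟨_, check_UptoHundredThreeKinked_piece1⟩
  · exact Or.inr ⟨_, check_UptoHundredThreeKinked_piece2⟩
  · exact Or.inr ⟨_, check_UptoHundredThreeKinked_piece3⟩
  · exact Or.inr ⟨_, check_UptoHundredThreeKinked_piece4⟩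
  · exact Or.inr ⟨_, check_UptoHundredThreeKinked_piece5⟩
  · exact Or.inr ⟨_, check_UptoHundredThreeKinked_piece6⟩
  · exact Or.inr ⟨_, check_UptoHundredThreeKinked_piece7⟩
  · exact Or.inr ⟨_, check_UptoHundredThreeKinked_piece8⟩
  · exact Or.inr ⟨_, check_UptoHundredThreeKinked_piece9⟩
  · exact Or.inr ⟨_, check_UptoHundredThreeKinked_piece10⟩
  · exact Or.inr ⟨_, check_UptoHundredThreeKinked_piece11⟩
  · exact Or.inr ⟨_, check_UptoHundredThreeKinked_piece12⟩
  · exact Or.inr ⟨_, check_UptoHundredThreeKinked_piece13⟩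
  · exact Or.inr ⟨_, check_UptoHundredThreeKinked_piece14⟩
  · exact Or.inr ⟨_, check_UptoHundredThreeKinked_piece15⟩
  · exact Or.inr ⟨_, check_UptoHundredThreeKinked_piece16⟩
  · exact Or.inr ⟨_, check_UptoHundredThreeKinked_piece17⟩
  · exact Or.inr ⟨_, check_UptoHundredThreeKinked_piece18⟩
  · exact Or.inr ⟨_, check_UptoHundredThreeKinked_piece19⟩
  · exact Or.inr ⟨_, check_UptoHundredThreeKinked_piece20⟩
  · exact Or.inr ⟨_, check_UptoHundredThreeKinked_piece21⟩
  · exact Or.inr ⟨_, check_UptoHundredThreeKinked_piece22⟩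
  · exact Or.inr ⟨_, check_UptoHundredThreeKinked_piece23⟩
  · exact Or.inr ⟨_, check_UptoHundredThreeKinked_piece24⟩
  · exact Or.inr ⟨_, check_UptoHundredThreeKinked_piece25⟩
  · exact Or.inr ⟨_, check_UptoHundredThreeKinked_piece26⟩
  · exact Or.inr ⟨_, check_UptoHundredThreeKinked_piece27⟩
  · exact Or.inr ⟨_, check_UptoHundredThreeKinked_piece28⟩
  · exact Or.inr ⟨_, check_UptoHundredThreeKinked_piece29⟩
  · exact Or.inr ⟨_, check_UptoHundredThreeKinked_piece30⟩
  · exact Or.inr ⟨_, check_UptoHundredThreeKinked_piece31⟩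
  · exact Or.inr ⟨_, check_UptoHundredThreeKinked_piece32⟩
  · exact Or.inr ⟨_, check_UptoHundredThreeKinked_piece33⟩
  · exact Or.inr ⟨_, check_UptoHundredThreeKinked_piece34⟩
  · exact Or.inr ⟨_, check_UptoHundredThreeKinked_piece35⟩
  · exact Or.inr ⟨_, check_UptoHundredThreeKinked_piece36⟩
  · exact Or.inr ⟨_, check_UptoHundredThreeKinked_piece37⟩
  · exact Or.inr ⟨_, check_UptoHundredThreeKinked_piece38⟩
  · exact Or.inr ⟨_, check_UptoHundredThreeKinked_piece39⟩
  · exact Or.inr ⟨_, check_UptoHundredThreeKinked_piece40⟩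
  · exact Or.inr ⟨_, check_UptoHundredThreeKinked_piece41⟩
  · exact Or.inr ⟨_, check_UptoHundredThreeKinked_piece42⟩
  · exact Or.inr ⟨_, check_UptoHundredThreeKinked_piece43⟩
  · exact Or.inr ⟨_, check_UptoHundredThreeKinked_piece44⟩
  · exact Or.inr ⟨_, check_UptoHundredThreeKinked_piece45⟩
  · exact Or.inr ⟨_, check_UptoHundredThreeKinked_piece46⟩
  · exact Or.inr ⟨_, check_UptoHundredThreeKinked_piece47⟩
  · exact Or.inr ⟨_, check_UptoHundredThreeKinked_piece48⟩
  · exact Or.inr ⟨_, check_UptoHundredThreeKinked_piece49⟩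
  · exact Or.inr ⟨_, check_UptoHundredThreeKinked_piece50⟩
  · exact Or.inr ⟨_, check_UptoHundredThreeKinked_piece51⟩
  · exact Or.inr ⟨_, check_UptoHundredThreeKinked_piece52⟩
  · exact Or.inr ⟨_, check_UptoHundredThreeKinked_piece53⟩
  · exact Or.inr ⟨_, check_UptoHundredThreeKinked_piece54⟩
  · exact Or.inr ⟨_, check_UptoHundredThreeKinked_piece55⟩
  · exact Or.inr ⟨_, check_UptoHundredThreeKinked_piece56⟩
  · exact Or.inr ⟨_, check_UptoHundredThreeKinked_piece57⟩
  · exact Or.inr ⟨_, check_UptoHundredThreeKinked_piece58⟩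
  · exact Or.inr ⟨_, check_UptoHundredThreeKinked_piece59⟩
  · exact Or.inr ⟨_, check_UptoHundredThreeKinked_piece60⟩
  · exact Or.inr ⟨_, check_UptoHundredThreeKinked_piece61⟩
  · exact Or.inr ⟨_, check_UptoHundredThreeKinked_piece62⟩
  · exact Or.inr ⟨_, check_UptoHundredThreeKinked_piece63⟩
  · exact Or.inr ⟨_, check_UptoHundredThreeKinked_piece64⟩
  · exact Or.inr ⟨_, check_UptoHundredThreeKinked_piece65⟩
  · exact Or.inr ⟨_, check_UptoHundredThreeKinked_piece66⟩
  · exact Or.inr ⟨_, check_UptoHundredThreeKinked_piece67⟩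
  · exact Or.inr ⟨_, check_UptoHundredThreeKinked_piece68⟩
  · exact Or.inr ⟨_, check_UptoHundredThreeKinked_piece69⟩
  · exact Or.inr ⟨_, check_UptoHundredThreeKinked_piece70⟩
  · exact Or.inr ⟨_, check_UptoHundredThreeKinked_piece71⟩
  · exact Or.inr ⟨_, check_UptoHundredThreeKinked_piece72⟩
  · exact Or.inr ⟨_, check_UptoHundredThreeKinked_piece73⟩
  · exact Or.inr ⟨_, check_UptoHundredThreeKinked_piece74⟩
  · exact Or.inr ⟨_, check_UptoHundredThreeKinked_piece75⟩
  · exact Or.inr ⟨_, check_UptoHundredThreeKinked_piece76⟩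
  · exact Or.inr ⟨_, check_UptoHundredThreeKinked_piece77⟩
  · exact Or.inr ⟨_, check_UptoHundredThreeKinked_piece78⟩
  · exact Or.inr ⟨_, check_UptoHundredThreeKinked_piece79⟩
  · exact Or.inr ⟨_, check_UptoHundredThreeKinked_piece80⟩
  · exact Or.inr ⟨_, check_UptoHundredThreeKinked_piece81⟩
  · exact Or.inr ⟨_, check_UptoHundredThreeKinked_piece82⟩
  · exact Or.inr ⟨_, check_UptoHundredThreeKinked_piece83⟩
  · exact Or.inr ⟨_, check_UptoHundredThreeKinked_piece84⟩
  · exact Or.inr ⟨_, check_UptoHundredThreeKinked_piece85⟩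
  · exact Or.inr ⟨_, check_UptoHundredThreeKinked_piece86⟩
  · exact Or.inr ⟨_, check_UptoHundredThreeKinked_piece87⟩
  · exact Or.inr ⟨_, check_UptoHundredThreeKinked_piece88⟩
  · exact Or.inr ⟨_, check_UptoHundredThreeKinked_piece89⟩
  · exact Or.inr ⟨_, check_UptoHundredThreeKinked_piece90⟩
  · exact Or.inr ⟨_, check_UptoHundredThreeKinked_piece91⟩
  · exact Or.inr ⟨_, check_UptoHundredThreeKinked_piece92⟩
  · exact Or.inr ⟨_, check_UptoHundredThreeKinked_piece93⟩
  · exact Or.inr ⟨_, check_UptoHundredThreeKinked_piece94⟩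
  · exact Or.inr ⟨_, check_UptoHundredThreeKinked_piece95⟩
  · exact Or.inr ⟨_, check_UptoHundredThreeKinked_piece96⟩
  · exact Or.inr ⟨_, check_UptoHundredThreeKinked_piece97⟩
  · exact Or.inr ⟨_, check_UptoHundredThreeKinked_piece98⟩
  · exact Or.inr ⟨_, check_UptoHundredThreeKinked_piece99⟩
  · exact Or.inr ⟨_, check_UptoHundredThreeKinked_piece100⟩
  · exact Or.inr ⟨_, check_UptoHundredThreeKinked_piece101⟩
  · exact Or.inr ⟨_, check_UptoHundredThreeKinked_piece102⟩
  · exact Or.inr ⟨_, check_UptoHundredThreeKinked_piece103⟩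
  · exact Or.inr ⟨_, check_UptoHundredThreeKinked_piece104⟩
  · exact Or.inr ⟨_, check_UptoHundredThreeKinked_piece105⟩
  · exact Or.inr ⟨_, check_UptoHundredThreeKinked_piece106⟩
  · exact Or.inr ⟨_, check_UptoHundredThreeKinked_piece107⟩
  · exact Or.inr ⟨_, check_UptoHundredThreeKinked_piece108⟩
  · exact Or.inr ⟨_, check_UptoHundredThreeKinked_piece109⟩
  · exact Or.inr ⟨_, check_UptoHundredThreeKinked_piece110⟩
  · exact Or.inr ⟨_, check_UptoHundredThreeKinked_piece111⟩
  · exact Or.inr ⟨_, check_UptoHundredThreeKinked_piece112⟩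
  · exact Or.inr ⟨_, check_UptoHundredThreeKinked_piece113⟩
  · exact Or.inr ⟨_, check_UptoHundredThreeKinked_piece114⟩
  · exact Or.inr ⟨_, check_UptoHundredThreeKinked_piece115⟩
  · exact Or.inr ⟨_, check_UptoHundredThreeKinked_piece116⟩
  · exact Or.inr ⟨_, check_UptoHundredThreeKinked_piece117⟩
  · exact Or.inr ⟨_, check_UptoHundredThreeKinked_piece118⟩
  · exact Or.inr ⟨_, check_UptoHundredThreeKinked_piece119⟩
  · exact Or.inr ⟨_, check_UptoHundredThreeKinked_piece120⟩
  · exact Or.inr ⟨_, check_UptoHundredThreeKinked_piece121⟩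
  · exact Or.inr ⟨_, check_UptoHundredThreeKinked_piece122⟩
  · exact Or.inr ⟨_, check_UptoHundredThreeKinked_piece123⟩
  · exact Or.inr ⟨_, check_UptoHundredThreeKinked_piece124⟩
  · exact Or.inr ⟨_, check_UptoHundredThreeKinked_piece125⟩
  · exact Or.inr ⟨_, check_UptoHundredThreeKinked_piece126⟩
  · exact Or.inr ⟨_, check_UptoHundredThreeKinked_piece127⟩
  · exact Or.inr ⟨_, check_UptoHundredThreeKinked_piece128⟩
  · exact Or.inr ⟨_, check_UptoHundredThreeKinked_piece129⟩
  · exact Or.inr ⟨_, check_UptoHundredThreeKinked_piece130⟩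
  · exact Or.inr ⟨_, check_UptoHundredThreeKinked_piece131⟩
  · exact Or.inr ⟨_, check_UptoHundredThreeKinked_piece132⟩
  · exact Or.inr ⟨_, check_UptoHundredThreeKinked_piece133⟩
  · exact Or.inr ⟨_, check_UptoHundredThreeKinked_piece134⟩
  · exact Or.inr ⟨_, check_UptoHundredThreeKinked_piece135⟩
  · exact Or.inr ⟨_, check_UptoHundredThreeKinked_piece136⟩
  · exact Or.inr ⟨_, check_UptoHundredThreeKinked_piece137⟩
  · exact Or.inr ⟨_, check_UptoHundredThreeKinked_piece138⟩
  · exact Or.inr ⟨_, check_UptoHundredThreeKinked_piece139⟩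
  · exact Or.inr ⟨_, check_UptoHundredThreeKinked_piece140⟩
  · exact Or.inr ⟨_, check_UptoHundredThreeKinked_piece141⟩
  · exact Or.inr ⟨_, check_UptoHundredThreeKinked_piece142⟩
  · exact Or.inr ⟨_, check_UptoHundredThreeKinked_piece143⟩
  · exact Or.inr ⟨_, check_UptoHundredThreeKinked_piece144⟩
  · exact Or.inr ⟨_, check_UptoHundredThreeKinked_piece145⟩
  · exact Or.inr ⟨_, check_UptoHundredThreeKinked_piece146⟩
  · exact Or.inr ⟨_, check_UptoHundredThreeKinked_piece147⟩
  · exact Or.inr ⟨_, check_UptoHundredThreeKinked_piece148⟩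
  · exact Or.inr ⟨_, check_UptoHundredThreeKinked_piece149⟩
  · exact Or.inr ⟨_, check_UptoHundredThreeKinked_piece150⟩
  · exact Or.inr ⟨_, check_UptoHundredThreeKinked_piece151⟩
  · exact Or.inr ⟨_, check_UptoHundredThreeKinked_piece152⟩
  · exact Or.inr ⟨_, check_UptoHundredThreeKinked_piece153⟩
  · exact Or.inr ⟨_, check_UptoHundredThreeKinked_piece154⟩
  · exact Or.inr ⟨_, check_UptoHundredThreeKinked_piece155⟩
  · exact Or.inr ⟨_, check_UptoHundredThreeKinked_piece156⟩
  · exact Or.inr ⟨_, check_UptoHundredThreeKinked_piece157⟩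
  · exact Or.inr ⟨_, check_UptoHundredThreeKinked_piece158⟩
  · exact Or.inr ⟨_, check_UptoHundredThreeKinked_piece159⟩
  · exact Or.inr ⟨_, check_UptoHundredThreeKinked_piece160⟩
  · exact Or.inr ⟨_, check_UptoHundredThreeKinked_piece161⟩
  · exact Or.inr ⟨_, check_UptoHundredThreeKinked_piece162⟩
  · exact Or.inr ⟨_, check_UptoHundredThreeKinked_piece163⟩
  · exact Or.inr ⟨_, check_UptoHundredThreeKinked_piece164⟩
  · exact Or.inr ⟨_, check_UptoHundredThreeKinked_piece165⟩
  · exact Or.inr ⟨_, check_UptoHundredThreeKinked_piece166⟩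
  · exact Or.inr ⟨_, check_UptoHundredThreeKinked_piece167⟩
  · exact Or.inr ⟨_, check_UptoHundredThreeKinked_piece168⟩
  · exact Or.inr ⟨_, check_UptoHundredThreeKinked_piece169⟩
  · exact Or.inr ⟨_, check_UptoHundredThreeKinked_piece170⟩
  · exact Or.inr ⟨_, check_UptoHundredThreeKinked_piece171⟩
  · exact Or.inr ⟨_, check_UptoHundredThreeKinked_piece172⟩
  · exact Or.inr ⟨_, check_UptoHundredThreeKinked_piece173⟩
  · exact Or.inr ⟨_, check_UptoHundredThreeKinked_piece174⟩
  · exact Or.inr ⟨_, check_UptoHundredThreeKinked_piece175⟩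
  · exact Or.inr ⟨_, check_UptoHundredThreeKinked_piece176⟩
  · exact Or.inr ⟨_, check_UptoHundredThreeKinked_piece177⟩
  · exact Or.inr ⟨_, check_UptoHundredThreeKinked_piece178⟩
  · exact Or.inr ⟨_, check_UptoHundredThreeKinked_piece179⟩
  · exact Or.inr ⟨_, check_UptoHundredThreeKinked_piece180⟩
  · exact Or.inr ⟨_, check_UptoHundredThreeKinked_piece181⟩
  · exact Or.inr ⟨_, check_UptoHundredThreeKinked_piece182⟩
  · exact Or.inr ⟨_, check_UptoHundredThreeKinked_piece183⟩
  · exact Or.inr ⟨_, check_UptoHundredThreeKinked_piece184⟩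
  · exact Or.inr ⟨_, check_UptoHundredThreeKinked_piece185⟩
  · exact Or.inr ⟨_, check_UptoHundredThreeKinked_piece186⟩
  · exact Or.inr ⟨_, check_UptoHundredThreeKinked_piece187⟩
  · exact Or.inr ⟨_, check_UptoHundredThreeKinked_piece188⟩
  · exact Or.inr ⟨_, check_UptoHundredThreeKinked_piece189⟩
  · exact Or.inr ⟨_, check_UptoHundredThreeKinked_piece190⟩
  · exact Or.inr ⟨_, check_UptoHundredThreeKinked_piece191⟩
  · exact Or.inr ⟨_, check_UptoHundredThreeKinked_piece192⟩
  · exact Or.inr ⟨_, check_UptoHundredThreeKinked_piece193⟩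
  · exact Or.inr ⟨_, check_UptoHundredThreeKinked_piece194⟩
  · exact Or.inr ⟨_, check_UptoHundredThreeKinked_piece195⟩
  · exact Or.inr ⟨_, check_UptoHundredThreeKinked_piece196⟩
  · exact Or.inr ⟨_, check_UptoHundredThreeKinked_piece197⟩
  · exact Or.inr ⟨_, check_UptoHundredThreeKinked_piece198⟩
  · exact Or.inr ⟨_, check_UptoHundredThreeKinked_piece199⟩
  · exact Or.inr ⟨_, check_UptoHundredThreeKinked_piece200⟩
  · exact Or.inr ⟨_, check_UptoHundredThreeKinked_piece201⟩
  · exact Or.inr ⟨_, check_UptoHundredThreeKinked_piece202⟩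
  · exact Or.inr ⟨_, check_UptoHundredThreeKinked_piece203⟩
  · exact Or.inr ⟨_, check_UptoHundredThreeKinked_piece204⟩
  · exact Or.inr ⟨_, check_UptoHundredThreeKinked_piece205⟩
  · exact Or.inr ⟨_, check_UptoHundredThreeKinked_piece206⟩
  · exact Or.inr ⟨_, check_UptoHundredThreeKinked_piece207⟩
  · exact Or.inr ⟨_, check_UptoHundredThreeKinked_piece208⟩
  · exact Or.inr ⟨_, check_UptoHundredThreeKinked_piece209⟩
  · exact Or.inr ⟨_, check_UptoHundredThreeKinked_piece210⟩
  · exact Or.inr ⟨_, check_UptoHundredThreeKinked_piece211⟩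
  · exact Or.inr ⟨_, check_UptoHundredThreeKinked_piece212⟩
  · exact Or.inr ⟨_, check_UptoHundredThreeKinked_piece213⟩
  · exact Or.inr ⟨_, check_UptoHundredThreeKinked_piece214⟩
  · exact Or.inr ⟨_, check_UptoHundredThreeKinked_piece215⟩
  · exact Or.inr ⟨_, check_UptoHundredThreeKinked_piece216⟩
  · exact Or.inr ⟨_, check_UptoHundredThreeKinked_piece217⟩
  · exact Or.inr ⟨_, check_UptoHundredThreeKinked_piece218⟩
  · exact Or.inr ⟨_, check_UptoHundredThreeKinked_piece219⟩
  · exact Or.inr ⟨_, check_UptoHundredThreeKinked_piece220⟩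
  · exact Or.inr ⟨_, check_UptoHundredThreeKinked_piece221⟩
  · exact Or.inr ⟨_, check_UptoHundredThreeKinked_piece222⟩
  · exact Or.inr ⟨_, check_UptoHundredThreeKinked_piece223⟩
  · exact Or.inr ⟨_, check_UptoHundredThreeKinked_piece224⟩
  · exact Or.inr ⟨_, check_UptoHundredThreeKinked_piece225⟩
  · exact Or.inr ⟨_, check_UptoHundredThreeKinked_piece226⟩
  · exact Or.inr ⟨_, check_UptoHundredThreeKinked_piece227⟩
  · exact Or.inr ⟨_, check_UptoHundredThreeKinked_piece228⟩
  · exact Or.inr ⟨_, check_UptoHundredThreeKinked_piece229⟩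
  · exact Or.inr ⟨_, check_UptoHundredThreeKinked_piece230⟩
  · exact Or.inr ⟨_, check_UptoHundredThreeKinked_piece231⟩
  · exact Or.inr ⟨_, check_UptoHundredThreeKinked_piece232⟩
  · exact Or.inr ⟨_, check_UptoHundredThreeKinked_piece233⟩
  · exact Or.inr ⟨_, check_UptoHundredThreeKinked_piece234⟩
  · exact Or.inr ⟨_, check_UptoHundredThreeKinked_piece235⟩
  · exact Or.inr ⟨_, check_UptoHundredThreeKinked_piece236⟩
  · exact Or.inr ⟨_, check_UptoHundredThreeKinked_piece237⟩
  · exact Or.inr ⟨_, check_UptoHundredThreeKinked_piece238⟩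
  · exact Or.inr ⟨_, check_UptoHundredThreeKinked_piece239⟩
  · exact Or.inr ⟨_, check_UptoHundredThreeKinked_piece240⟩
  · exact Or.inr ⟨_, check_UptoHundredThreeKinked_piece241⟩
  · exact Or.inr ⟨_, check_UptoHundredThreeKinked_piece242⟩
  · exact Or.inr ⟨_, check_UptoHundredThreeKinked_piece243⟩
  · exact Or.inr ⟨_, check_UptoHundredThreeKinked_piece244⟩
  · exact Or.inr ⟨_, check_UptoHundredThreeKinked_piece245⟩
  · exact Or.inr ⟨_, check_UptoHundredThreeKinked_piece246⟩
  · exact Or.inr ⟨_, check_UptoHundredThreeKinked_piece247⟩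

end Summit.RiemannHypothesis.RiemannHypothesis.Theorems.SemilocalPolyWitness

end
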